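import Literature.AlgebraicGeometry.HodgeTheory.SemiregularityAnnihilatesObstructions
import HarnessLib

/-!
# A semiregular sheaf has unobstructed deformations (Buchweitz–Flenner 2003, Thm. 7.3, smoothness clause) —
# vector-bundle case on a fixed complex projective manifold, infinitesimal form

Family `hodge`, layer `Literature/AlgebraicGeometry/HodgeTheory`. ONE NAMED FACT (D-0014) and PROVED bridges. Typed
for the cross-ladder literature-typing tranche LT-H1 «semiregularity consumers» (director-hodge g4, 2026-08-26; item
(b) «Buchweitz–Flenner 2003 […] obstruction criterion»). The sibling `SemiregularityAnnihilatesObstructions.lean` types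
[BandieraLepriManetti2023, Cor. 1.1] («`σ_k` annihilates ALL obstructions», 2023) and PROVES from it the lifting
statement below; this file records the SAME lifting statement as what it has been since 2003: the smoothness clause
of [BuchweitzFlenner2003, Thm. 7.3] (REFEREED, Compositio Math. 137), proved there by a different route (curvilinear
obstructions, Thm. 6.7 (4)) — so that a consumer may cite «semiregular ⟹ unobstructed» BY NAME with the 2003 trust
base, and the bridge `…_of_annihilates` shows the 2023 fact implies it. GRADE: REFEREED. Nothing here asserts HC ∕
HC_AV ∕ any Weil-class statement.

## Sources, verbatim (held text `paper:arxiv-math_9912245` = Compositio Math. 137 (2003) 135–210)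

* **Theorem 7.3** [corpus:paper:arxiv-math_9912245 p0032:L108–150] («In case of deformations of modules on a fixed
  complex space `X = X_0`, that is, when `Σ` is a reduced point»): «Let `ℱ_0` be a coherent module on `X` with a finite
  dimensional space of infinitesimal deformations `Ext¹_X(ℱ_0, ℱ_0)`, and let `S ∈ 𝔉` be the basis of a formally
  semiuniversal deformation of `ℱ_0`. If `ℱ_0` has locally finite projective dimension as an `𝒪_X`–module then the
  semiregularity map `σ : Ext²_X(ℱ_0, ℱ_0) → ∏_{n ≥ 0} H^{n+2}(X, Λⁿ 𝕃_X)` is defined and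
  `dim S ≥ dim_ℂ Ext¹_X(ℱ_0, ℱ_0) − dim_ℂ ker σ`. In particular, if `σ` is injective then `S` is smooth.» Proof
  (ibid.): «Let `ℱ` be a deformation of `ℱ_0` over an artinian germ `T`, whence `ℱ` is an `𝒪_{X×T}`–module that is flat
  over `T` and induces `ℱ_0` on `X`. The functor `𝒩 ↦ H^p(X × T, 𝒩 ⊗_{𝒪_T} Λ^q 𝕃_{X×T∕T}) ≅ 𝒩 ⊗_ℂ H^p(X, Λ^q 𝕃_X)`,
  `𝒩 ∈ Coh T`, is exact. As the semiregularity map is compatible with base change `T → S`, see (3.5), the result follows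
  as before from (4.11).»; followed by «As a special case this contains the result of Artamkin–Mukai, [Art, Muk], that
  the injectivity of the trace map `Ext²_X(ℱ_0, ℱ_0) → H²(X, 𝒪_X)` implies smoothness of the basis of the semiuniversal
  deformation of `ℱ_0`.»
* §7, Lemma 7.1 and the paragraph before it [p0032:L4–31, L41–42]: deformations of coherent modules over germs `S`, «the objects
  over a germ `S` are coherent `S`–flat modules `ℱ` on `X_S := X ×_Σ S`», «by (3.4) `⟨[X_{S'}], At(ℱ)⟩ = 0` if and only if
  there is a module `ℱ'` on `X_{S'}` that forms an extension of `ℱ` by `ℱ ⊗_{𝒪_S} 𝒩`», «the space of infinitesimal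
  deformations of `ℱ` over `S[𝒩]` is just `Ext¹_{X_S}(ℱ, ℱ ⊗_{𝒪_S} 𝒩)`».
* **Theorem 6.7** [p0029:L41–66] (smoothness of the base of a formally semiuniversal deformation): «(1) The germ `(S,0)`
  is smooth over a closed subspace of the completion `(Σ̂, 0)` […] (3) For every `b ∈ 𝔈(T)` over an artinian germ `T`,
  the map of infinitesimal deformations `Ex(b∕T, 𝒪_T) → Ex(b∕T, 𝒪_T∕𝔪_T)` is surjective. Moreover, if `Σ` is a reduced
  point, then these are equivalent to the following condition. (4) The map in (3) is surjective for every `b ∈ 𝔈(T)`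
  over an artinian curvilinear germ `T`» — for `Σ` a point, (1) says `S` is smooth.
* Introduction [p0004:L29–31, L49–53]: «we will show that the basis of the semiuniversal deformation of `ℱ` is smooth if the
  semiregularity map `σ` is injective […] it would show that all obstructions of `ℱ` vanish under `σ` and not merely the
  curvilinear ones as we show here» (the latter since proved: [BandieraLepriManetti2023, Cor. 1.1],
  [Pridham2024Semiregularity, Rem. 2.23] — sibling file).
* GLUE (standard, [Schlessinger1968, Thm. 2.11, Remark 2.10]; [Hartshorne2010, Thm. 7.1 (b)]): the base `S` of a
  formally semiuniversal (= miniversal) deformation of `ℱ_0` is smooth iff the deformation functor `Def_{ℱ_0}` on local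
  Artinian `ℂ`-algebras is smooth, i.e. iff every deformation over `B` lifts along every small surjection `A ↠ B`, and
  it suffices to lift along PRINCIPAL small extensions (kernel `≅ ℂ`); for `ℱ_0` locally free the deformations stay
  locally free ([Hartshorne2010, §7, Ex. 7.1]) and lifting is governed by the obstruction of Thm. 7.1 (b), the tree's
  `Deformation.illusieObstruction` ∕ `Deformation.LiftsAlong`.

## Rendering (binders ↔ print; identical telescope to `BandieraLepriManetti2023_semiregularityMap_annihilatesObstructions`)

`X : Motives.SchemeOver ℂ` smooth projective of dimension `n` («compact complex manifold», here algebraic and projective —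
the case in which BF's `H^{n+2}(X, Λⁿ𝕃_X) = H^{n+2}(X, Ωⁿ_X)` and the tree's `σ_q` agree); `ℱ_0` ↦ a FINITE LOCALLY FREE
sheaf (special case of «coherent of locally finite projective dimension»; `Ext¹` is then finite-dimensional
automatically), presented as the restriction `j^*F` of a vector bundle `F` on `X_B = X × Spec B` (a deformation over the
local Artinian `B` with `ℂ`-point `ρ`); «`σ` injective» ↦ `IsISemiregular (hF.pullback j) Set.univ` (the WHOLE real map
`(σ_q)_q`, `SemiregularityHigherSigma.lean`; BF's scalars `(−1)^q∕q!` do not change injectivity over `ℂ`); «`S` is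
smooth» ↦ for every principal small surjection `f : A ↠ B` (`𝔪_A · ker f = 0`, the square-zero ideal of
`i : X_B ↪ X_A = X × Spec A` identified with `i_* j_* 𝒪_X` by `eI`, `i` a first-order thickening of the separated `X_A`,
`j ≫ i ≫ g_A = 𝟙_X`), `F` lifts to a vector bundle on `X_A` (`Deformation.LiftsAlong i F`).

## What is PROVED here

* `BuchweitzFlenner2003_semiregularSheaf_deformationsUnobstructed_of_annihilates` — the 2023 fact
  `BandieraLepriManetti2023_semiregularityMap_annihilatesObstructions` IMPLIES this fact (it is the sibling's
  `liftsAlong_of_isISemiregular_univ_of_annihilates`, universally closed).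
* `BuchweitzFlenner2003_semiregularSheaf_deformationsUnobstructed.liftsAlong_of_isISemiregular` — under the fact,
  `I`-semiregularity for ANY `I ⊆ ℕ` already gives the lift (`(σ_q)_{q ∈ I}` jointly injective ⟹ `σ` injective,
  `IsISemiregular.mono`).

## Faithfulness sheet

* `BuchweitzFlenner2003_semiregularSheaf_deformationsUnobstructed` — FAITHFUL to the clause «if `σ` is injective then `S`
  is smooth» of Thm. 7.3 read through the glue above; WEAKER than Thm. 7.3 as printed (special case `ℱ_0` locally free on
  an algebraic complex projective manifold; the dimension inequality `dim S ≥ dim Ext¹ − dim ker σ` is NOT typed — no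
  carrier for the hull of `Def_ℱ`; its abstract pro-representable form is `Deformation/ObstructionSpaceDimensionBound.lean`,
  [BuchweitzFlenner2003, Cor. 6.11 ∕ Prop. 6.13 (2)]). REFEREED. Not a restatement of a tree fact: the only tree
  statements implying it are the 2023∕2024 facts (sibling file; `Pridham2024_ISemiregular_liftsOverHodgeLocus_model` at
  `S = Spec ℂ`, whose instantiation is not carried out here — TODO).

## References

* [BuchweitzFlenner2003] Compositio Math. 137 (2003), Thm. 7.3, Lemma 7.1, Thm. 6.7, Introduction; Def. 4.1, §5.
* [BandieraLepriManetti2023] Adv. Math. 435 (2023) 109358, Cor. 1.1. [Pridham2024Semiregularity] Rem. 2.23.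
* [Hartshorne2010] Deformation Theory, Thm. 7.1 (b), Ex. 7.1. [Schlessinger1968] Thm. 2.11, Rem. 2.10.
-/

noncomputable section

open CategoryTheory CategoryTheory.Limits AlgebraicGeometry

namespace Literature.AlgebraicGeometry.HodgeTheory

open Literature.AlgebraicGeometry.Deformation Literature.AlgebraicGeometry.Modules
  Literature.AlgebraicGeometry.Motives

/-- **Buchweitz–Flenner 2003, Thm. 7.3 (smoothness clause): a semiregular sheaf on a fixed space has unobstructed
deformations — vector-bundle case on a complex projective manifold, infinitesimal form.** Printed
[corpus:paper:arxiv-math_9912245 p0032:L112–134]: «Let `ℱ_0` be a coherent module on `X` with a finite dimensional space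
of infinitesimal deformations `Ext¹_X(ℱ_0, ℱ_0)`, and let `S` be the basis of a formally semiuniversal deformation of
`ℱ_0`. If `ℱ_0` has locally finite projective dimension as an `𝒪_X`–module then the semiregularity map
`σ : Ext²_X(ℱ_0, ℱ_0) → ∏_{n≥0} H^{n+2}(X, Λⁿ𝕃_X)` is defined and `dim S ≥ dim_ℂ Ext¹_X(ℱ_0, ℱ_0) − dim_ℂ ker σ`. In
particular, if `σ` is injective then `S` is smooth.» Rendering (module docstring; «`S` smooth» ⟺ `Def_{ℱ_0}` smooth ⟺
lifting along principal small extensions, [Schlessinger1968]; lifts of a locally free `ℱ_0` are locally free,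
[Hartshorne2010, Thm. 7.1]): for `X` smooth projective over `ℂ`, a principal small surjection `f : A ↠ B` of local
Artinian `ℂ`-algebras with the constant deformations `X_A ⊇ X_B ⊇ X` as pullback squares (`j ≫ i ≫ g_A = 𝟙_X`, `eI` the
identification of the ideal of `i` with `i_* j_* 𝒪_X`), and a vector bundle `F` on `X_B` whose restriction `j^*F` to `X`
has INJECTIVE semiregularity map `σ = (σ_q)_{q ≥ 0}` (`IsISemiregular (hF.pullback j) Set.univ`): `F` lifts to a vector
bundle on `X_A` (`Deformation.LiftsAlong i F`). Only the smoothness clause; the dimension inequality is not typed. Grade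
REFEREED. Implied by [BandieraLepriManetti2023, Cor. 1.1] (`…_of_annihilates`, proved below).
[cite: BuchweitzFlenner2003, Thm. 7.3 (with Lemma 7.1, Thm. 6.7)] [cite: Hartshorne2010, Thm. 7.1 (b)] -/
def BuchweitzFlenner2003_semiregularSheaf_deformationsUnobstructed : Prop :=
  ∀ ⦃X : Motives.SchemeOver ℂ⦄ (n : ℕ), Motives.IsSmoothProjective n X →
    ∀ (A B : Type) [CommRing A] [Algebra ℂ A] [IsArtinianRing A] [IsLocalRing A]
      [CommRing B] [Algebra ℂ B] (f : A →ₐ[ℂ] B), Function.Surjective f →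
      IsLocalRing.maximalIdeal A * RingHom.ker f = ⊥ →
      ∀ (ρ : B →ₐ[ℂ] ℂ) ⦃XA XB : Scheme⦄ (gA : XA ⟶ X.left) (qA : XA ⟶ Spec (.of A)),
        IsPullback gA qA X.hom (Spec.map (CommRingCat.ofHom (algebraMap ℂ A))) →
        ∀ (i : XB ⟶ XA) (qB : XB ⟶ Spec (.of B)),
          IsPullback i qB qA (Spec.map (CommRingCat.ofHom f.toRingHom)) →
          ∀ (j : X.left ⟶ XB),
            IsPullback j X.hom qB (Spec.map (CommRingCat.ofHom ρ.toRingHom)) →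
            j ≫ i ≫ gA = 𝟙 X.left →
            ∀ [IsFirstOrderThickening i] [XA.IsSeparated]
              (_eI : (Scheme.Modules.pushforward i).obj
                  ((Scheme.Modules.pushforward j).obj (unitModule X.left)) ≅ idealModule i)
              (F : XB.Modules) (hF : Motives.IsFiniteLocallyFree F),
              IsISemiregular (hF.pullback j) Set.univ → LiftsAlong i F

/-- **2023 ⟹ 2003**: the fact `BandieraLepriManetti2023_semiregularityMap_annihilatesObstructions` («`σ_q` kills every
obstruction», [BandieraLepriManetti2023, Cor. 1.1]) implies `BuchweitzFlenner2003_semiregularSheaf_deformationsUnobstructed`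
(«`σ` injective ⟹ unobstructed», [BuchweitzFlenner2003, Thm. 7.3]) — the sibling file's
`liftsAlong_of_isISemiregular_univ_of_annihilates`, universally closed. PROVED.
[cite: BuchweitzFlenner2003, Thm. 7.3] [cite: BandieraLepriManetti2023, Cor. 1.1] -/
theorem BuchweitzFlenner2003_semiregularSheaf_deformationsUnobstructed_of_annihilates
    (h : BandieraLepriManetti2023_semiregularityMap_annihilatesObstructions) :
    BuchweitzFlenner2003_semiregularSheaf_deformationsUnobstructed :=
  fun _X n hX A B _ _ _ _ _ _ f hf hsmall ρ _XA _XB gA qA hA i qB hB j hj hji _ _ eI F hF hsr =>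
    liftsAlong_of_isISemiregular_univ_of_annihilates h n hX A B f hf hsmall ρ gA qA hA i qB hB j hj hji eI F hF hsr

/-- **`I`-semiregular ⟹ unobstructed** under the fact: if already the components `(σ_q)_{q ∈ I}` are jointly injective
on `Ext²_X(j^*F, j^*F)` for SOME `I ⊆ ℕ` (`IsISemiregular (hF.pullback j) I`; BF §5 «`I`-semiregular»), then `σ` is
injective (`IsISemiregular.mono`) and `F` lifts. PROVED from the fact.
[cite: BuchweitzFlenner2003, Thm. 7.3 and §5 (I-semiregular)] -/
theorem BuchweitzFlenner2003_semiregularSheaf_deformationsUnobstructed.liftsAlong_of_isISemiregular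
    (h : BuchweitzFlenner2003_semiregularSheaf_deformationsUnobstructed)
    {X : Motives.SchemeOver ℂ} (n : ℕ) (hX : Motives.IsSmoothProjective n X)
    (A B : Type) [CommRing A] [Algebra ℂ A] [IsArtinianRing A] [IsLocalRing A] [CommRing B] [Algebra ℂ B]
    (f : A →ₐ[ℂ] B) (hf : Function.Surjective f) (hsmall : IsLocalRing.maximalIdeal A * RingHom.ker f = ⊥)
    (ρ : B →ₐ[ℂ] ℂ) {XA XB : Scheme} (gA : XA ⟶ X.left) (qA : XA ⟶ Spec (.of A))
    (hA : IsPullback gA qA X.hom (Spec.map (CommRingCat.ofHom (algebraMap ℂ A))))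
    (i : XB ⟶ XA) (qB : XB ⟶ Spec (.of B))
    (hB : IsPullback i qB qA (Spec.map (CommRingCat.ofHom f.toRingHom)))
    (j : X.left ⟶ XB) (hj : IsPullback j X.hom qB (Spec.map (CommRingCat.ofHom ρ.toRingHom)))
    (hji : j ≫ i ≫ gA = 𝟙 X.left) [IsFirstOrderThickening i] [XA.IsSeparated]
    (eI : (Scheme.Modules.pushforward i).obj ((Scheme.Modules.pushforward j).obj (unitModule X.left)) ≅
      idealModule i)
    (F : XB.Modules) (hF : Motives.IsFiniteLocallyFree F) (I : Set ℕ)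
    (hsr : IsISemiregular (hF.pullback j) I) : LiftsAlong i F :=
  h n hX A B f hf hsmall ρ gA qA hA i qB hB j hj hji eI F hF
    (IsISemiregular.mono (hF.pullback j) (fun _ _ => Set.mem_univ _) hsr)

end Literature.AlgebraicGeometry.HodgeTheory

end
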